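import Summits.CriticalPhenomena.PercolationContinuityZ3.Theorems.FK.BoundaryConditionInfluenceTV
import Summits.CriticalPhenomena.PercolationContinuityZ3.Theorems.FK.FKSharpnessPrintedForms
import Summits.CriticalPhenomena.PercolationContinuityZ3.Theorems.FK.FKCriticalValueSquareLattice
import HarnessLib

/-!
# EXPONENTIAL WEAK MIXING OF THE RANDOM-CLUSTER MEASURE IN THE WHOLE SUBCRITICAL PHASE, `d ≥ 2`, `q ≥ 1`
# (Alexander's weak mixing property (1.1) for every `p < p_c(q)`), and exponential convergence of the finite-volume
# measures uniformly in the boundary condition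

Claimed R42 (8)(c) in the cell INBOX at 2026-08-28T10:00:12Z by fkp-10a gen 353 (NEW CLAIM #1 of the gen), under provision (ι) (no coordinator seated since gen 267's closing line l.8331: the lane lead absorbs the registry word, silence = consent; readers fk-ref / fkt-lead / fkp-18r / fkp-10b); lineage row FO-10a-g353 (self-suggested), package g353-weakmixing, label WM-D.
Helper file of the `fk-continuity` build cell (bschramm lane; `--supports stmt-CriticalPhenomena-4575`); builds on
p205010 (kernel theorem, internal audit signed; external expert review pending). No definitions, no named facts, no
sorries; standard axioms. UNCONDITIONAL.

The boundary-condition influence files (`BoundaryConditionInfluence{,Zd,TV}.lean`: Duminil-Copin's Exercise 10 and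
Strassen's coupling) bound every influence of information outside `Λ_n` on events inside `Λ_k` by the ONE-ARM
PROBABILITY `φ¹_{Λ_{n−k},p,q}(0 ↔ ∂Λ_{n−k})` of the wired BOX measure; the sharpness theorem of
Duminil-Copin–Raoufi–Tassion (2019) AS PRINTED — the lineage's `exists_exp_decay_thetaWiredBox_of_lt_rcCriticalProb`,
`φ¹_{Λ_n,p,q}[0 ↔ ∂Λ_n] ≤ e^{−cn}` for `p < p_c(q)` — makes it exponentially small. Alexander (1998) proved weak
mixing (indeed ratio weak mixing) for the planar random-cluster model under exponential decay of connectivity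
(Thm. 3.4); the finite-volume wired decay of DRT gives the weak mixing property (1.1) in EVERY dimension `d ≥ 2`
throughout the subcritical phase. For `d ≥ 2`, `q ≥ 1`, `0 ≤ p < p_c(q)` there is `c = c(p, q, d) > 0` such that for
EVERY measure `P` of the sandwich class `FKGibbs d p q` (in particular `φ⁰_{p,q}`, `φ¹_{p,q}`), all `k < n`, every
event `H` determined by finitely many edges off `E_{Λ_n}`:

* `exists_exp_weakMixing_of_lt_rcCriticalProb` — **`|P(A ∩ H) − P(A)·P(H)| ≤ P(H) · |Λ_k| · e^{−c(n−k)}`** for `A`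
  increasing (or decreasing: `…_of_isLowerSet`) determined by `E_{Λ_k}`;
* `exists_exp_weakMixing_local_of_lt_rcCriticalProb` — **`|P(E ∩ H) − P(E)·P(H)| ≤ 4 · P(H) · |F| · e^{−c(n−k)}`** for
  EVERY event `E` determined by a set `F ⊆ E_{Λ_k}` of edges (Alexander's (1.1): the total-variation distance on
  `E_{Λ_k}` between the conditional law given `H` and `P` is at most `C |E_{Λ_k}| e^{−c(n−k)}`);
* `exists_exp_finiteVolume_approx_of_lt_rcCriticalProb` — **`|φ^b_{Λ_n,p,q}(E) − P(E)| ≤ 4 · |F| · e^{−c(n−k)}`** for both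
  boundary conditions `b`: the finite-volume measures converge exponentially fast, UNIFORMLY IN THE BOUNDARY
  CONDITION, to the (unique) infinite-volume measure; `exists_exp_influence_of_lt_rcCriticalProb` —
  `0 ≤ φ¹_{Λ_n}(A) − φ⁰_{Λ_n}(A) ≤ |Λ_k| e^{−c(n−k)}` for increasing `A` in `Λ_k`;
* `exists_exp_weakMixing_two_of_lt_selfDual` — on `ℤ²` the same for every `p < √q/(1+√q)` (`p_c(q) = p_sd(q)`, the
  lineage's `rcCriticalProb_two_eq`).

HONEST FRAMING: subcritical only (`p < p_c(q)`); nothing is claimed at `p_c(q)` or above (where weak mixing of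
`φ¹_{p,q}` for `p > p_c` and the behaviour at `p_c` are different questions: ratio weak mixing, Alexander Thm. 3.3,
is NOT formalised here). Not a binder discharge; `n_open = 2` unchanged.

## References

* K. S. Alexander, *On weak mixing in lattice models*, Probab. Theory Relat. Fields 110 (1998) 441–471: the weak
  mixing property (1.1) and its form `sup{|P(A | B) − P(A)| : A ∈ F_Δ, B ∈ F_{Λ^c}}` (p. 444), Thm. 3.4 (planar FK
  model), Remark 3.5. [Alexander1998]
* H. Duminil-Copin, A. Raoufi, V. Tassion, *Sharpness of the phase transition for random-cluster and Potts models via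
  decision trees*, Ann. of Math. 189 (2019) 75–99, Thm. 1.2 (1). [DuminilCopinRaoufiTassion2019]
* H. Duminil-Copin, *Lectures on the Ising and Potts models on the hypercubic lattice* (2019), §1.2 Exercise 10.
  [DuminilCopin2019]
* G. Grimmett, *The Random-Cluster Model*, Springer 2006: Lemma (4.13), Lemma (4.14)(b), Thm. (4.19), Thm. (5.33)
  (uniqueness when `θ¹ = 0`). [Grimmett2006]
* V. Beffara, H. Duminil-Copin, PTRF 153 (2012) 511–542 (`p_c(q) = √q/(1+√q)` on `ℤ²`). [BeffaraDuminilCopin2012]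
-/

noncomputable section

namespace Summit.CriticalPhenomena.PercolationContinuityZ3.Theorems.FK

namespace BoundaryInfluence

open MeasureTheory Finset
open Literature.Probability.Percolation Literature.Probability.LatticeModels Literature.Barriers.CriticalPhenomena
open Literature.Probability.Percolation.OneArmOSSS Literature.Probability.Percolation.DCT16 MonotonicOSSS

variable {d : ℕ} {p q : ℝ}

/-! ### Boxes: the one-arm sum is `≤ 2 |F| · thetaWiredBox d p q (n − k)` -/

/-- The region law is subadditive. [folklore] -/
theorem regionWiredReal_union_le (p q : ℝ) (Λ : Finset (Site d)) (A B : Set (BondConfig (Site d))) :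
    regionWiredReal d p q Λ (A ∪ B) ≤ regionWiredReal d p q Λ A + regionWiredReal d p q Λ B := by
  simp only [regionWiredReal, Set.preimage_union]
  exact measureReal_union_le _ _

/-- **On boxes the one-arm sum is a wired box arm probability**: for `F ⊆ E_{Λ_k}` and `k ≤ n`,
`Σ_{e ∈ F} φ¹_{Λ_n,p,q}(J(e, Λ_n)) ≤ 2 · |F| · φ¹_{Λ_{n−k},p,q}(0 ↔ ∂Λ_{n−k})` (both endpoints of `e` lie in `Λ_k`, and
`x + Λ_{n−k} ⊆ Λ_n` for `x ∈ Λ_k`). [cite: Grimmett2006, Thm. (4.19)(a) proof eq. (4.24) and §4.3 (translations); DuminilCopinRaoufiTassion2019, §3] -/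
theorem sum_regionWiredReal_joined_edge_box_le (hd : 1 ≤ d) {p q : ℝ} (hp : p ∈ Set.Icc (0 : ℝ) 1) (hq : 1 ≤ q)
    {k n : ℕ} (hkn : k ≤ n) {F : Finset (Sym2 (Site d))} (hF : F ⊆ edgesIn (zdGraph d) (box d k)) :
    ∑ e ∈ F, regionWiredReal d p q (box d n)
        {ω | ∃ x ∈ e, ∃ y ∈ innerBoundary (zdGraph d) (box d n), ω ∈ openConnIn (↑(box d n) : Set (Site d)) x y} ≤
      2 * #F * thetaWiredBox d p q (n - k) := by
  have h : ∀ e ∈ F, regionWiredReal d p q (box d n)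
      {ω | ∃ x ∈ e, ∃ y ∈ innerBoundary (zdGraph d) (box d n), ω ∈ openConnIn (↑(box d n) : Set (Site d)) x y} ≤
      2 * thetaWiredBox d p q (n - k) := by
    intro e he
    have he' := mem_edgesIn_iff.1 (hF he)
    have hx : ∀ x ∈ e, regionWiredReal d p q (box d n)
        {ω | ∃ y ∈ innerBoundary (zdGraph d) (box d n), ω ∈ openConnIn (↑(box d n) : Set (Site d)) x y} ≤
        thetaWiredBox d p q (n - k) := fun x hx =>
      regionWiredReal_joined_box_le_thetaWiredBox hd hp hq (by have := mem_box_iff_siteRad_le.1 (he'.2 x hx); omega)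
    induction e using Sym2.ind with
    | h a b =>
      have hset : {ω : BondConfig (Site d) | ∃ x ∈ s(a, b), ∃ y ∈ innerBoundary (zdGraph d) (box d n),
          ω ∈ openConnIn (↑(box d n) : Set (Site d)) x y} =
          {ω | ∃ y ∈ innerBoundary (zdGraph d) (box d n), ω ∈ openConnIn (↑(box d n) : Set (Site d)) a y} ∪
          {ω | ∃ y ∈ innerBoundary (zdGraph d) (box d n), ω ∈ openConnIn (↑(box d n) : Set (Site d)) b y} := by
        ext ω; simp only [Set.mem_setOf_eq, Sym2.mem_iff, exists_eq_or_imp, exists_eq_left, Set.mem_union]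
      rw [hset]
      refine (regionWiredReal_union_le p q _ _ _).trans ?_
      have ha := hx a (Sym2.mem_mk_left a b)
      have hb := hx b (Sym2.mem_mk_right a b)
      linarith
  refine (Finset.sum_le_sum h).trans (le_of_eq ?_)
  rw [Finset.sum_const, nsmul_eq_mul]
  ring

/-! ### The influence decays exponentially below `p_c(q)` -/

/-- **Exponential decay of the boundary-condition influence below `p_c(q)`**: for `d ≥ 2`, `q ≥ 1`,
`0 ≤ p < p_c(q)` there is `c > 0` with `φ¹_{Λ_n,p,q}(J(Λ_k, Λ_n)) ≤ |Λ_k| · e^{−c(n−k)}` for all `k < n`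
(`J(Λ_k, Λ_n)` = "some site of `Λ_k` is joined to `∂Λ_n` inside `Λ_n`").
[cite: DuminilCopinRaoufiTassion2019, Thm. 1.2 (1); Grimmett2006, Thm. (4.19)(a) proof eq. (4.24)] -/
theorem exists_exp_decay_joined_of_lt_rcCriticalProb (hd : 2 ≤ d) (hq : 1 ≤ q) (hp0 : 0 ≤ p)
    (hpc : p < rcCriticalProb d q) :
    ∃ c : ℝ, 0 < c ∧ ∀ k n : ℕ, k < n →
      regionWiredReal d p q (box d n)
          {ω | ∃ x ∈ box d k, ∃ y ∈ innerBoundary (zdGraph d) (box d n),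
            ω ∈ openConnIn (↑(box d n) : Set (Site d)) x y} ≤
        #(box d k) * Real.exp (-(c * ((n : ℝ) - k))) := by
  have hd1 : 1 ≤ d := by omega
  have hp : p ∈ Set.Icc (0 : ℝ) 1 := ⟨hp0, (hpc.trans (rcCriticalProb_lt_one hd hq)).le⟩
  obtain ⟨c, hc, hdec⟩ := exists_exp_decay_thetaWiredBox_of_lt_rcCriticalProb hd hq hp0 hpc
  refine ⟨c, hc, fun k n hkn => ?_⟩
  refine (regionWiredReal_joined_box_box_le hd1 hp hq hkn.le).trans ?_
  refine mul_le_mul_of_nonneg_left ?_ (Nat.cast_nonneg _)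
  have h := hdec (n - k) (by omega)
  rwa [Nat.cast_sub hkn.le] at h

/-- **`0 ≤ φ¹_{Λ_n,p,q}(A) − φ⁰_{Λ_n,p,q}(A) ≤ |Λ_k| · e^{−c(n−k)}` below `p_c(q)`** for every increasing event `A`
determined by `E_{Λ_k}`, `k < n` (one `c = c(p, q, d) > 0`): exponentially small influence of the boundary
condition in the subcritical phase. [cite: DuminilCopinRaoufiTassion2019, Thm. 1.2 (1); DuminilCopin2019, §1.2 Exercise 10 (3)] -/
theorem exists_exp_influence_of_lt_rcCriticalProb (hd : 2 ≤ d) (hq : 1 ≤ q) (hp0 : 0 ≤ p)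
    (hpc : p < rcCriticalProb d q) :
    ∃ c : ℝ, 0 < c ∧ ∀ k n : ℕ, k < n → ∀ A : Set (BondConfig (Site d)), IsUpperSet A →
      DeterminedBy A ↑(edgesIn (zdGraph d) (box d k)) →
        regionWiredReal d p q (box d n) A - regionFreeReal d p q (box d n) A ∈
          Set.Icc 0 (#(box d k) * Real.exp (-(c * ((n : ℝ) - k)))) := by
  have hp : p ∈ Set.Icc (0 : ℝ) 1 := ⟨hp0, (hpc.trans (rcCriticalProb_lt_one hd hq)).le⟩
  obtain ⟨c, hc, hdec⟩ := exists_exp_decay_joined_of_lt_rcCriticalProb hd hq hp0 hpc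
  refine ⟨c, hc, fun k n hkn A hA hAk => ⟨regionWiredReal_sub_regionFreeReal_nonneg hp hq (box_mono d hkn.le) hA hAk, ?_⟩⟩
  exact (regionWiredReal_sub_regionFreeReal_le hp hq (box_mono d hkn.le) hA hAk).trans (hdec k n hkn)

/-! ### Weak mixing below `p_c(q)` (Alexander's (1.1)) -/

section WeakMixing

/-- **EXPONENTIAL WEAK MIXING BELOW `p_c(q)`, increasing events**: for `d ≥ 2`, `q ≥ 1`, `0 ≤ p < p_c(q)` there is
`c > 0` such that for EVERY FK-Gibbs measure `P` at `(p, q)`, all `k < n`, every increasing `A` determined by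
`E_{Λ_k}` and every `H` determined by finitely many pairs off `E_{Λ_n}`:
`|P(A ∩ H) − P(A)·P(H)| ≤ P(H) · |Λ_k| · e^{−c(n−k)}`. [cite: Alexander1998, (1.1) and p. 444, Thm. 3.4; DuminilCopinRaoufiTassion2019, Thm. 1.2 (1)] -/
theorem exists_exp_weakMixing_of_lt_rcCriticalProb (hd : 2 ≤ d) (hq : 1 ≤ q) (hp0 : 0 ≤ p)
    (hpc : p < rcCriticalProb d q) :
    ∃ c : ℝ, 0 < c ∧ ∀ ⦃P : Measure (BondConfig (Site d))⦄, FKGibbs d p q P → ∀ ⦃k n : ℕ⦄, k < n →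
      ∀ ⦃A : Set (BondConfig (Site d))⦄, IsUpperSet A → DeterminedBy A ↑(edgesIn (zdGraph d) (box d k)) →
      ∀ ⦃H : Set (BondConfig (Site d))⦄ (T : Finset (Sym2 (Site d))),
        Disjoint (↑T : Set (Sym2 (Site d))) ↑(edgesIn (zdGraph d) (box d n)) → DeterminedBy H ↑T →
          |P.real (A ∩ H) - P.real A * P.real H| ≤ P.real H * (#(box d k) * Real.exp (-(c * ((n : ℝ) - k)))) := by
  have hp : p ∈ Set.Icc (0 : ℝ) 1 := ⟨hp0, (hpc.trans (rcCriticalProb_lt_one hd hq)).le⟩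
  obtain ⟨c, hc, hdec⟩ := exists_exp_decay_joined_of_lt_rcCriticalProb hd hq hp0 hpc
  refine ⟨c, hc, fun P hP k n hkn A hA hAk H T hT hH => ?_⟩
  refine (FKGibbs.abs_real_inter_sub_mul_le_joined hP hp hq (box_mono d hkn.le) hA hAk T hT hH).trans ?_
  exact mul_le_mul_of_nonneg_left (hdec k n hkn) measureReal_nonneg

/-- **Exponential weak mixing below `p_c(q)`, decreasing events.** [cite: Alexander1998, (1.1), Thm. 3.4; DuminilCopinRaoufiTassion2019, Thm. 1.2 (1)] -/
theorem exists_exp_weakMixing_of_lt_rcCriticalProb_of_isLowerSet (hd : 2 ≤ d) (hq : 1 ≤ q) (hp0 : 0 ≤ p)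
    (hpc : p < rcCriticalProb d q) :
    ∃ c : ℝ, 0 < c ∧ ∀ ⦃P : Measure (BondConfig (Site d))⦄, FKGibbs d p q P → ∀ ⦃k n : ℕ⦄, k < n →
      ∀ ⦃D : Set (BondConfig (Site d))⦄, IsLowerSet D → DeterminedBy D ↑(edgesIn (zdGraph d) (box d k)) →
      ∀ ⦃H : Set (BondConfig (Site d))⦄ (T : Finset (Sym2 (Site d))),
        Disjoint (↑T : Set (Sym2 (Site d))) ↑(edgesIn (zdGraph d) (box d n)) → DeterminedBy H ↑T →
          |P.real (D ∩ H) - P.real D * P.real H| ≤ P.real H * (#(box d k) * Real.exp (-(c * ((n : ℝ) - k)))) := by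
  have hp : p ∈ Set.Icc (0 : ℝ) 1 := ⟨hp0, (hpc.trans (rcCriticalProb_lt_one hd hq)).le⟩
  obtain ⟨c, hc, hdec⟩ := exists_exp_decay_joined_of_lt_rcCriticalProb hd hq hp0 hpc
  refine ⟨c, hc, fun P hP k n hkn D hD hDk H T hT hH => ?_⟩
  refine (FKGibbs.abs_real_inter_sub_mul_le_joined_of_isLowerSet hP hp hq (box_mono d hkn.le) hD hDk T hT hH).trans ?_
  exact mul_le_mul_of_nonneg_left (hdec k n hkn) measureReal_nonneg

/-- **EXPONENTIAL WEAK MIXING BELOW `p_c(q)` FOR ARBITRARY LOCAL EVENTS (Alexander's weak mixing property (1.1))**: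
for `d ≥ 2`, `q ≥ 1`, `0 ≤ p < p_c(q)` there is `c > 0` such that for EVERY FK-Gibbs measure `P` at `(p, q)`, all
`k < n`, every event `E` determined by a set `F ⊆ E_{Λ_k}` of edges and every `H` determined by finitely many pairs off
`E_{Λ_n}`: `|P(E ∩ H) − P(E)·P(H)| ≤ 4 · P(H) · |F| · e^{−c(n−k)}`.
[cite: Alexander1998, (1.1) and p. 444, Thm. 3.4; DuminilCopinRaoufiTassion2019, Thm. 1.2 (1); Liggett2005, Cor. II.2.8] -/
theorem exists_exp_weakMixing_local_of_lt_rcCriticalProb (hd : 2 ≤ d) (hq : 1 ≤ q) (hp0 : 0 ≤ p)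
    (hpc : p < rcCriticalProb d q) :
    ∃ c : ℝ, 0 < c ∧ ∀ ⦃P : Measure (BondConfig (Site d))⦄, FKGibbs d p q P → ∀ ⦃k n : ℕ⦄, k < n →
      ∀ ⦃F : Finset (Sym2 (Site d))⦄, F ⊆ edgesIn (zdGraph d) (box d k) →
      ∀ ⦃E : Set (BondConfig (Site d))⦄, DeterminedBy E ↑F →
      ∀ ⦃H : Set (BondConfig (Site d))⦄ (T : Finset (Sym2 (Site d))),
        Disjoint (↑T : Set (Sym2 (Site d))) ↑(edgesIn (zdGraph d) (box d n)) → DeterminedBy H ↑T →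
          |P.real (E ∩ H) - P.real E * P.real H| ≤ 4 * P.real H * #F * Real.exp (-(c * ((n : ℝ) - k))) := by
  have hd1 : 1 ≤ d := by omega
  have hp : p ∈ Set.Icc (0 : ℝ) 1 := ⟨hp0, (hpc.trans (rcCriticalProb_lt_one hd hq)).le⟩
  obtain ⟨c, hc, hdec⟩ := exists_exp_decay_thetaWiredBox_of_lt_rcCriticalProb hd hq hp0 hpc
  refine ⟨c, hc, fun P hP k n hkn F hF E hE H T hT hH => ?_⟩
  have hFn : F ⊆ edgesIn (zdGraph d) (box d n) := hF.trans (edgesIn_zdGraph_mono (box_mono d hkn.le))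
  refine (FKGibbs.abs_real_inter_sub_mul_le_two_mul_sum hP hp hq (box d n) T hT hH hFn hE).trans ?_
  have hS := sum_regionWiredReal_joined_edge_box_le hd1 hp hq hkn.le hF (p := p) (q := q)
  have hθ := hdec (n - k) (by omega)
  rw [Nat.cast_sub hkn.le] at hθ
  have hH0 : 0 ≤ P.real H := measureReal_nonneg
  have hF0 : (0 : ℝ) ≤ #F := Nat.cast_nonneg _
  calc 2 * P.real H * ∑ e ∈ F, regionWiredReal d p q (box d n)
          {ω | ∃ x ∈ e, ∃ y ∈ innerBoundary (zdGraph d) (box d n), ω ∈ openConnIn (↑(box d n) : Set (Site d)) x y}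
      ≤ 2 * P.real H * (2 * #F * thetaWiredBox d p q (n - k)) := mul_le_mul_of_nonneg_left hS (by positivity)
    _ ≤ 2 * P.real H * (2 * #F * Real.exp (-(c * ((n : ℝ) - k)))) :=
        mul_le_mul_of_nonneg_left (mul_le_mul_of_nonneg_left hθ (by positivity)) (by positivity)
    _ = 4 * P.real H * #F * Real.exp (-(c * ((n : ℝ) - k))) := by ring

end WeakMixing

/-! ### Exponential convergence of the finite-volume measures, uniformly in the boundary condition -/

section FiniteVolume

/-- **`|P(E) − φ⁰_{Λ_n,p,q}(E)| ≤ 2·|F|·e^{−c(n−k)}` and `|P(E) − φ¹_{Λ_n,p,q}(E)| ≤ 4·|F|·e^{−c(n−k)}` below `p_c(q)`**,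
for every FK-Gibbs measure `P` at `(p, q)` (in particular `φ⁰_{p,q} = φ¹_{p,q}`), every event `E` determined by
`F ⊆ E_{Λ_k}`, `k < n`: the free and wired finite-volume measures converge to the infinite-volume measure
exponentially fast, uniformly in the boundary condition. [cite: DuminilCopinRaoufiTassion2019, Thm. 1.2 (1); Grimmett2006, Thm. (4.19) and Thm. (5.33); Alexander1998, (1.1)] -/
theorem exists_exp_finiteVolume_approx_of_lt_rcCriticalProb (hd : 2 ≤ d) (hq : 1 ≤ q) (hp0 : 0 ≤ p)
    (hpc : p < rcCriticalProb d q) :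
    ∃ c : ℝ, 0 < c ∧ ∀ ⦃P : Measure (BondConfig (Site d))⦄, FKGibbs d p q P → ∀ ⦃k n : ℕ⦄, k < n →
      ∀ ⦃F : Finset (Sym2 (Site d))⦄, F ⊆ edgesIn (zdGraph d) (box d k) →
      ∀ ⦃E : Set (BondConfig (Site d))⦄, DeterminedBy E ↑F →
        |P.real E - regionFreeReal d p q (box d n) E| ≤ 2 * #F * Real.exp (-(c * ((n : ℝ) - k))) ∧
        |P.real E - regionWiredReal d p q (box d n) E| ≤ 4 * #F * Real.exp (-(c * ((n : ℝ) - k))) := by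
  have hd1 : 1 ≤ d := by omega
  have hp : p ∈ Set.Icc (0 : ℝ) 1 := ⟨hp0, (hpc.trans (rcCriticalProb_lt_one hd hq)).le⟩
  obtain ⟨c, hc, hdec⟩ := exists_exp_decay_thetaWiredBox_of_lt_rcCriticalProb hd hq hp0 hpc
  refine ⟨c, hc, fun P hP k n hkn F hF E hE => ?_⟩
  have hFn : F ⊆ edgesIn (zdGraph d) (box d n) := hF.trans (edgesIn_zdGraph_mono (box_mono d hkn.le))
  have hS := sum_regionWiredReal_joined_edge_box_le hd1 hp hq hkn.le hF (p := p) (q := q)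
  have hθ := hdec (n - k) (by omega)
  rw [Nat.cast_sub hkn.le] at hθ
  have hF0 : (0 : ℝ) ≤ #F := Nat.cast_nonneg _
  have hbound : ∑ e ∈ F, regionWiredReal d p q (box d n)
      {ω | ∃ x ∈ e, ∃ y ∈ innerBoundary (zdGraph d) (box d n), ω ∈ openConnIn (↑(box d n) : Set (Site d)) x y} ≤
      2 * #F * Real.exp (-(c * ((n : ℝ) - k))) :=
    hS.trans (mul_le_mul_of_nonneg_left hθ (by positivity))
  constructor
  · exact (FKGibbs.abs_real_sub_regionFreeReal_le_sum hP hp hq (box d n) hFn hE).trans hbound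
  · refine (FKGibbs.abs_real_sub_regionWiredReal_le_two_mul_sum hP hp hq (box d n) hFn hE).trans ?_
    linarith

/-- The same in terms of the box laws `φ^b_{Λ_n,p,q}` of `InfiniteVolumeDefs` (`rcBoxLaw`), both boundary conditions at
once: `|φ^b_{Λ_n,p,q}(E) − P(E)| ≤ 4·|F|·e^{−c(n−k)}`. [cite: DuminilCopinRaoufiTassion2019, Thm. 1.2 (1); Grimmett2006, Thm. (4.19)] -/
theorem exists_exp_rcBoxLaw_approx_of_lt_rcCriticalProb (hd : 2 ≤ d) (hq : 1 ≤ q) (hp0 : 0 ≤ p)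
    (hpc : p < rcCriticalProb d q) :
    ∃ c : ℝ, 0 < c ∧ ∀ ⦃P : Measure (BondConfig (Site d))⦄, FKGibbs d p q P → ∀ (b : Bool) ⦃k n : ℕ⦄, k < n →
      ∀ ⦃F : Finset (Sym2 (Site d))⦄, F ⊆ edgesIn (zdGraph d) (box d k) →
      ∀ ⦃E : Set (BondConfig (Site d))⦄, DeterminedBy E ↑F →
        |(rcBoxLaw d b p q n).real E - P.real E| ≤ 4 * #F * Real.exp (-(c * ((n : ℝ) - k))) := by
  obtain ⟨c, hc, h⟩ := exists_exp_finiteVolume_approx_of_lt_rcCriticalProb hd hq hp0 hpc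
  refine ⟨c, hc, fun P hP b k n hkn F hF E hE => ?_⟩
  have hEm : MeasurableSet E := hE.measurableSet_of_finset
  obtain ⟨h0, h1⟩ := h hP hkn hF hE
  have hF0 : (0 : ℝ) ≤ #F := Nat.cast_nonneg _
  have hexp : 0 ≤ Real.exp (-(c * ((n : ℝ) - k))) := (Real.exp_pos _).le
  cases b
  · rw [← regionFreeReal_box p q n hEm, abs_sub_comm]
    exact h0.trans (by nlinarith)
  · rw [← regionWiredReal_box p q n hEm, abs_sub_comm]
    exact h1

/-- **Two FK-Gibbs measures at `(p, q)`, `p < p_c(q)`, agree up to `4·|F|·e^{−c(n−k)}` on every event determined by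
`F ⊆ E_{Λ_k}`, for every `n > k`** — the quantitative form of uniqueness of the infinite-volume measure below `p_c(q)`
(the qualitative statement is the tree's `fkGibbs_iff_eq_rcLimit_false_of_lt_rcCriticalProb`, not restated).
[cite: Grimmett2006, Thm. (5.33)(a) and (4.36); DuminilCopinRaoufiTassion2019, Thm. 1.2 (1)] -/
theorem exists_exp_abs_real_sub_real_le_of_lt_rcCriticalProb (hd : 2 ≤ d) (hq : 1 ≤ q) (hp0 : 0 ≤ p)
    (hpc : p < rcCriticalProb d q) :
    ∃ c : ℝ, 0 < c ∧ ∀ ⦃P P' : Measure (BondConfig (Site d))⦄, FKGibbs d p q P → FKGibbs d p q P' →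
      ∀ ⦃k n : ℕ⦄, k < n → ∀ ⦃F : Finset (Sym2 (Site d))⦄, F ⊆ edgesIn (zdGraph d) (box d k) →
      ∀ ⦃E : Set (BondConfig (Site d))⦄, DeterminedBy E ↑F →
        |P.real E - P'.real E| ≤ 4 * #F * Real.exp (-(c * ((n : ℝ) - k))) := by
  obtain ⟨c, hc, h⟩ := exists_exp_finiteVolume_approx_of_lt_rcCriticalProb hd hq hp0 hpc
  refine ⟨c, hc, fun P P' hP hP' k n hkn F hF E hE => ?_⟩
  have h1 := (h hP hkn hF hE).1
  have h2 := (h hP' hkn hF hE).1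
  rw [abs_le] at h1 h2 ⊢
  constructor <;> linarith [h1.1, h1.2, h2.1, h2.2]

end FiniteVolume

/-! ### The square lattice: weak mixing for every `p < √q/(1+√q)` -/

/-- **ℤ²: exponential weak mixing for all `q ≥ 1` and `0 ≤ p < p_sd(q) = √q/(1+√q)`** (the whole subcritical phase
of the planar random-cluster model, `p_c(q) = p_sd(q)` being the lineage's `rcCriticalProb_two_eq`): for arbitrary
local events `E` determined by `F ⊆ E_{Λ_k}` and `H` off `E_{Λ_n}`, `|P(E ∩ H) − P(E)·P(H)| ≤ 4·P(H)·|F|·e^{−c(n−k)}` for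
every FK-Gibbs `P`. [cite: Alexander1998, Thm. 3.4 and Remark 3.5; BeffaraDuminilCopin2012, Thm. 1; DuminilCopinRaoufiTassion2019, Thm. 1.2 and Thm. 1.3] -/
theorem exists_exp_weakMixing_two_of_lt_selfDual (hq : 1 ≤ q) (hp0 : 0 ≤ p)
    (hpsd : p < Real.sqrt q / (1 + Real.sqrt q)) :
    ∃ c : ℝ, 0 < c ∧ ∀ ⦃P : Measure (BondConfig (Site 2))⦄, FKGibbs 2 p q P → ∀ ⦃k n : ℕ⦄, k < n →
      ∀ ⦃F : Finset (Sym2 (Site 2))⦄, F ⊆ edgesIn (zdGraph 2) (box 2 k) →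
      ∀ ⦃E : Set (BondConfig (Site 2))⦄, DeterminedBy E ↑F →
      ∀ ⦃H : Set (BondConfig (Site 2))⦄ (T : Finset (Sym2 (Site 2))),
        Disjoint (↑T : Set (Sym2 (Site 2))) ↑(edgesIn (zdGraph 2) (box 2 n)) → DeterminedBy H ↑T →
          |P.real (E ∩ H) - P.real E * P.real H| ≤ 4 * P.real H * #F * Real.exp (-(c * ((n : ℝ) - k))) := by
  have hpc : p < rcCriticalProb 2 q := by rw [rcCriticalProb_two_eq hq]; exact hpsd
  exact exists_exp_weakMixing_local_of_lt_rcCriticalProb le_rfl hq hp0 hpc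

end BoundaryInfluence

end Summit.CriticalPhenomena.PercolationContinuityZ3.Theorems.FK

end
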